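import Literature.NumberTheory.EllipticCurves.CastellaGrossiLeeSkinner2022.HowardDivisibilityAnyClassNumber
import Literature.NumberTheory.EllipticCurves.MastellaZerman2026.HowardDivisibilityScalarImage
import HarnessLib

/-!
# The μ-part of the Heegner-point containment at `p ∣ h_K`, FRAME-FREE, in the stabilised currency
# (`MuPartStabilizedOfPrint`) — one residual letter for rows 9 (PrintX9) and 10 (PrintX10b)

Cell `pub/bsd-print-x9`, seat `bsd-line-x9-p1-w2` (g3). A STATEMENT ABBREVIATION ONLY (`abbrev … : Prop` with a body;
NOT asserted, NOT a named fact, no citation tag on the abbrev — it is the cell's beyond-print residual, not a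
published result); no `sorry`, no instance. ROUTE-INDEPENDENT: this module imports no `Theses` file, so that both
route cones can import it (director-bsd g13, 2026-08-28T10:02:41Z (1): «ONE ITEM, TWO ROWS — file the promoted μ-stub
ONCE (by-signature dedup) wanted by BOTH PrintX9 (under 27077) and PrintX10b (under 27275)»; the registered row
letters `Stmt.muPartSharp` / `Stmt.muInequalityStabilized` differ by their frame binders — `ClassX9 W p` versus
`ClassX10 W p ∧ ¬ Surj W 3 ∧ ¬ W.HasCM` — so no by-signature dedup is possible on them).

THE LETTER. `MuPartStabilizedOfPrint`: for every level `N`, curve `W/ℚ`, number field `K`, prime `p`,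
`ℤ_p`-extension datum `(κ, γ)` and `jbar`, UNDER the standing hypotheses of the cited any-class-number print
(`CastellaGrossiLeeSkinner2022.Thm413Hypotheses N W K p κ γ`: `E` elliptic of conductor `N`, `p` odd good
ordinary, `K` imaginary quadratic with `p ∤ d_K`, `E(K)[p] = 0`, Heegner hypothesis for `N`, `d_K` odd `≠ −3`,
`κ` anticyclotomic with topological generator `γ`) TOGETHER WITH the image hypotheses of Mastella–Zerman 2026
Cor. 4.6 (`E` non-CM, `E[p]` irreducible over `ℚ` and over `K`, scalars `1 + pℤ_p` in the `p`-adic image —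
`MastellaZerman2026.HasPadicScalarImage`), `p` split in `K`, and `p ∣ h_K` (the regime NOT covered by MZ26's
standing Assumption 2.1 (iii)): for all `Λ`-adic Selmer data `D`, CGLS stabilised Heegner data `C` and Selmer duals
`X` with `𝔖 = D.S`, `𝒳 = X.X` finitely generated and `𝔖/Λκ_∞(C)` torsion,
`length_{Λ_(p)}(𝒳_tors) ≤ 2 · length_{Λ_(p)}(𝔖/Λκ_∞(C))` — Howard's Theorem B (c) AT THE PRIME `(p)` for the
stabilised class, i.e. the output of his Eisenstein specialisation `𝔮 = T^m + p` (How04, proof of Thm. 2.2.10),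
which print proves only under `p ∤ h_K`. Both rows' frames specialise to it (X9: `ClassX9` dot-API +
`X9.thm413Hypotheses_of_lightFrame`; X10b: `ClassX10.hasPadicScalarImage_of_not_surj` +
`X10.thm413Hypotheses_of_classX10`), and the crux closers `PrintX9SharpMuStabilized.…_of_muStabilized` (p624590) /
its X10b twin turn it into the deciding cruxes BY NAME (files `…OfMuStabilizedGeneric`).
«beyond-print theorem»: no (nothing is proved here). BSD is NOT proved by this file.
-/

set_option linter.dupNamespace false
set_option autoImplicit false

noncomputable section

open Literature Literature.NumberTheory.EllipticCurves WeierstrassCurve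

namespace Summit.BirchSwinnertonDyer.BirchSwinnertonDyer.Theorems.HeegnerMuPartStabilized

/-- **The μ-part of the Heegner-point containment at `p ∣ h_K`, frame-free, stabilised currency**: under
`CastellaGrossiLeeSkinner2022.Thm413Hypotheses N W K p κ γ`, `E` non-CM, `E[p]` irreducible over `ℚ` and over `K`,
scalars `1 + pℤ_p` in the `p`-adic image, `p` split in `K` and `p ∣ h_K`: for all `D`, `C`, `X` with `𝔖`, `𝒳`
finitely generated and `𝔖/Λκ_∞(C)` torsion, `length_(p)(𝒳_tors) ≤ 2 · length_(p)(𝔖/Λκ_∞(C))`. A statement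
abbreviation (the cell's beyond-print residual of rows 9/10 in the currency the Kolyvagin road delivers); NOT
asserted, NOT a named fact, no citation tag; no witness in the tree. -/
abbrev MuPartStabilizedOfPrint : Prop :=
  ∀ (N : ℕ) [NeZero N] (W : WeierstrassCurve ℚ) [W.IsGloballyMinimal] (K : Type) [Field K] [NumberField K]
    (p : ℕ) [Fact p.Prime] (κ : ZpExtension K p) (γ : Field.absoluteGaloisGroup K)
    (jbar : AlgebraicClosure K →+* ℂ),
    CastellaGrossiLeeSkinner2022.Thm413Hypotheses N W K p κ γ →
    ¬ W.HasCM → W.HasIrreducibleModPGaloisRep p → (W.baseChange K).HasIrreducibleModPGaloisRep p →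
    MastellaZerman2026.HasPadicScalarImage W p → SatisfiesHeegnerHypothesis p K →
    p ∣ NumberField.classNumber K →
    ∀ (D : (W.baseChange K).LambdaAdicSelmerData κ γ)
      (C : CastellaGrossiLeeSkinner2022.StabilizedHeegnerData N W K κ jbar)
      (X : (W.baseChange K).SelmerDualData κ γ),
    Module.Finite (IwasawaAlgebra p) D.S → Module.Finite (IwasawaAlgebra p) X.X →
    Module.IsTorsion (IwasawaAlgebra p) (D.S ⧸ CastellaGrossiLeeSkinner2022.stabilizedHeegnerModule D C) →
    ∀ 𝔭 : PrimeSpectrum (IwasawaAlgebra p), 𝔭.asIdeal = Ideal.span {(p : IwasawaAlgebra p)} →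
      Module.lengthAt (IwasawaAlgebra p) (Submodule.torsion (IwasawaAlgebra p) X.X) 𝔭 ≤
        2 * Module.lengthAt (IwasawaAlgebra p)
          (D.S ⧸ CastellaGrossiLeeSkinner2022.stabilizedHeegnerModule D C) 𝔭

/-- Unfolding lemma (`Iff.rfl`), for item filing by signature. [folklore] -/
theorem muPartStabilizedOfPrint_iff :
    MuPartStabilizedOfPrint ↔
      ∀ (N : ℕ) [NeZero N] (W : WeierstrassCurve ℚ) [W.IsGloballyMinimal] (K : Type) [Field K] [NumberField K]
        (p : ℕ) [Fact p.Prime] (κ : ZpExtension K p) (γ : Field.absoluteGaloisGroup K)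
        (jbar : AlgebraicClosure K →+* ℂ),
        CastellaGrossiLeeSkinner2022.Thm413Hypotheses N W K p κ γ →
        ¬ W.HasCM → W.HasIrreducibleModPGaloisRep p → (W.baseChange K).HasIrreducibleModPGaloisRep p →
        MastellaZerman2026.HasPadicScalarImage W p → SatisfiesHeegnerHypothesis p K →
        p ∣ NumberField.classNumber K →
        ∀ (D : (W.baseChange K).LambdaAdicSelmerData κ γ)
          (C : CastellaGrossiLeeSkinner2022.StabilizedHeegnerData N W K κ jbar)
          (X : (W.baseChange K).SelmerDualData κ γ),
        Module.Finite (IwasawaAlgebra p) D.S → Module.Finite (IwasawaAlgebra p) X.X →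
        Module.IsTorsion (IwasawaAlgebra p) (D.S ⧸ CastellaGrossiLeeSkinner2022.stabilizedHeegnerModule D C) →
        ∀ 𝔭 : PrimeSpectrum (IwasawaAlgebra p), 𝔭.asIdeal = Ideal.span {(p : IwasawaAlgebra p)} →
          Module.lengthAt (IwasawaAlgebra p) (Submodule.torsion (IwasawaAlgebra p) X.X) 𝔭 ≤
            2 * Module.lengthAt (IwasawaAlgebra p)
              (D.S ⧸ CastellaGrossiLeeSkinner2022.stabilizedHeegnerModule D C) 𝔭 :=
  Iff.rfl

end Summit.BirchSwinnertonDyer.BirchSwinnertonDyer.Theorems.HeegnerMuPartStabilized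

end
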